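import Mathlib
import HarnessLib.Audit
import Summits.PneNP.PneNP.Theorems.PstarUnionCaseBFiveTwo
import Summits.PneNP.PneNP.Theorems.PstarUnionCaseBSingle
import Summits.PneNP.PneNP.Theorems.PstarUnionCases

/-!
# The union lemma `UnionFive` holds (ROUND-24, memo §14.3 / §14.21; ASK T-O2-G (U1/U2), T-UNION-TRI)

FRONTIER range-avoidance ladder, rung F-N3, ROUND 24 (cell `pnp-ideate`, planner memo `r24/CORE-BOUND-NOTES.md` §14.3 «UNION FORM» (the fresh-partner residual of O2) and §14.13–§14.25
(Case A / Case B programme of planner p3 g22); restricted-model proof complexity — nothing here bears on `P` versus `NP`).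

* `caseBFive_holds : CaseBFive` — Case B (the shared constraint reads a chord private): at least two chords `PstarUnionCaseBFiveTwo.caseB_two_chords`, one chord
  `PstarUnionCaseBSingle.caseB_single_chord`;
* `unionFive_holds : UnionFive` — **THE UNION LEMMA** (`PstarUnion.UnionFive`, typed by planner p3 g21 as the fresh-partner part of T-O2-4): a union-terminal core whose monomials
  avoid the chord privates has at most five members (`PstarUnionCases.unionFive_of_caseBFive` + `PstarUnionCaseAFive.caseAFive_holds`);
* `terminalFiveFresh_holds : TerminalFiveFresh` — its named consequence (U2) `PstarUnion.terminalFiveFresh_of_unionFive`: terminal cores all of whose privates-reading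
  monomials are gates on ONE fresh variable have at most five outputs.
-/

set_option linter.dupNamespace false -- `Summit.PneNP.PneNP.…`: summit = sub-problem name (D-0017 single-conjunct layout)

open Finset Literature.Computability.Complexity
open Summit.PneNP.PneNP.Theorems.PstarUnion (UnionFive TerminalFiveFresh terminalFiveFresh_of_unionFive)
open Summit.PneNP.PneNP.Theorems.PstarUnionCases (CaseBFive unionFive_of_caseBFive)
open Summit.PneNP.PneNP.Theorems.PstarUnionCaseBFiveTwo (caseB_two_chords)
open Summit.PneNP.PneNP.Theorems.PstarUnionCaseBSingle (caseB_single_chord)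

namespace Summit.PneNP.PneNP.Theorems.PstarUnionFive

/-- **`CaseBFive` holds**: Case B of the union lemma. -/
theorem caseBFive_holds : CaseBFive := by
  intro n m r I hI hT hS hE y J₀ A₀ A₁ w₂ hU F hF hP hmax hchord hun hread
  by_cases htwo : 2 ≤ (J₀ \ F).card
  · exact caseB_two_chords I hI hT hS hE hU hF hP hmax hchord hun hread htwo
  · exact caseB_single_chord I hI hT hS hE hU hF hP hmax hchord hun hread (by omega)

/-- **THE UNION LEMMA `UnionFive` holds.** -/
theorem unionFive_holds : UnionFive :=
  unionFive_of_caseBFive caseBFive_holds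

/-- **`TerminalFiveFresh` holds** (U2). -/
theorem terminalFiveFresh_holds : TerminalFiveFresh :=
  terminalFiveFresh_of_unionFive unionFive_holds

end Summit.PneNP.PneNP.Theorems.PstarUnionFive
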